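import Summits.HodgeConjecture.CorCM.Census.CyclicCharacterArcObstruction

/-!
# Cyclic characters, XII: THE FLIP-ORBIT REDUCTION — the arc block together with ONE orbit of single flips is a complete reduction target

COR-CM (cell `pub-hodgecm2`), count-neutral kernel combinatorics by the binder seat b09 (gen 42; lane CYCLIC-CHARACTER FIBRE LAW, part XII — the
REPAIR of the arc-type road map after the fibre obstruction of part XI `Census/CyclicCharacterArcObstruction.lean`), on gen 38ʼs
`Census/NondegenerateReduction.lean` (`typeSum_sum_baseVec`, `sum_eq_sum_type_add`, `two_pow_smul_mem_sup_of_forall_single`, `reduction_of_residual`),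
`Census/ResidualReductionTools.lean` (`mapDomain_rt_mem_target`), `Census/BaseBlockNearTypes.lean` (`residual_cases`) and gen 41ʼs part IX
(`sum_baseVec_arcType_mem_span_pairSet_of_mem_hodgeSpan`: a Hodge combination of arc types is a sum of pairs) BY NAME.  Theorems only (no definition,
no `decide`, no certificate, no named fact, no `sorry`).
HONEST FRAMING: `HC_CM` is NOT proved, here or anywhere in the tree; nothing here is a period or a headline.

THE SETTING of parts I–XI: `c` a central involution, `w : G → ℤ/2ᵏ` additive and onto with `w c ≠ 0`, `T_0 = w⁻¹(arc)` the arc type, `s₀ ∈ T_0`,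
`Φ₁ = T_0^{(s₀)}` its single flip at the place of `s₀`, and the FLIP ORBIT `{Φ₁·Q⁻¹ : Q ∈ G}` (the single flips at the position of `s₀` of all arc
types).  Part XI showed that no lattice `L ≤ hodgeSpan` reduces the single flips onto the arc block alone (the type sums of the arc block are
fibre-constant).  THE REPAIRED TARGET is `R = arc block ∪ flip orbit`: its type sums have full rank, and

**THEOREM (`two_pow_smul_mem_of_flipOrbit_reduction`, §4).**  Let `ℤ⟨pairs⟩ ≤ L ≤ hodgeSpan`.  Suppose
* (RED) every type `Φ` has `2ʲ·[Φ] ∈ (L + ℤ⟨arc block⟩) + ℤ⟨flip orbit⟩`;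
* (FIB) for every value `t`, the FIBRE SUM `Σ_{w Q = t} [Φ₁·Q⁻¹]` has `2^{j'}·(fibre sum) ∈ L + ℤ⟨arc block⟩`.
Then **`2^{j'+j} · hodgeSpan ≤ L`**.
PROOF.  `2ʲ y = ℓ + Σ a_Q [T_0·Q⁻¹] + Σ b_Q [Φ₁·Q⁻¹]` with the last two sums forming a Hodge vector `z`.  The type sum of `z` at `x` is a function
of `w x` plus `b(x⁻¹ c s₀) − b(x⁻¹ s₀)` (§1: the flip moves one point of one fibre), so constancy of the type sum forces the antisymmetrisation
`β(Q) = b_Q − b_{cQ}` to be FIBRE-CONSTANT (`β Q = β Q'` when `w Q = w Q'`, §2).  Summing over the transversal `T_0` of `G/⟨c⟩` (§3),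
`Σ b_Q [Φ₁·Q⁻¹] = (pairs) + Σ_{Q ∈ T_0} β(Q) [Φ₁·Q⁻¹] = (pairs) + Σ_{t ∈ arc} β̄(t)·(fibre sum at t)`, so by (FIB) `2^{j'} z ∈ L + ℤ⟨arc block⟩`,
and the arc remainder is a Hodge combination of arc types, hence a sum of pairs (part IX §3): `2^{j'} z ∈ L`.
§5 packages the theorem for `L = ℤ⟨pairs⟩ + ℤ[G]·S` with (FIB) at the single value `t = 0` (base change moves the fibre sums around:
`fibreSum_eq_mapDomain`) and in the two-stage form of the road map: gen 38ʼs cover (integral reduction to potential `≤ 1`) + the reduction of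
every single flip `T_0^{(s)}` onto `R` up to `2ʲ` (`two_pow_smul_mem_psp_of_single_flips'`) — the CORRECTED step (flip′) — + (FIB).
Part XIII (`Census/CyclicCharacterFlipOrbitMeta.lean`) re-issues the three META theorems of part X on this engine.

## References
* [Pohlmann1968] H. Pohlmann, Algebraic cycles on abelian varieties of complex multiplication type, Ann. of Math. 88 (1968), Thm 1.
* [Milne1999] J. S. Milne, Lefschetz motives and the Tate conjecture, Compositio Math. 117 (1999), Prop. 2.1, p. 54.
-/

namespace Summit.HodgeConjecture.CorCM.Census.CyclicCharacter

open Finset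
open Summit.HodgeConjecture.CorCM.Prior.AllgGroup.RfwfAllgGroup
open Summit.HodgeConjecture.CorCM.Census.BlockParity
open Summit.HodgeConjecture.CorCM.Census.Coinvariant
open Summit.HodgeConjecture.CorCM.Census.TwistGeneration
open Summit.HodgeConjecture.CorCM.Census.Nondegenerate
open Summit.HodgeConjecture.CorCM.Census.BaseBlock
open Summit.HodgeConjecture.CorCM.Census.OddIndex

noncomputable section

variable {G : Type*} [Group G] [Fintype G] [DecidableEq G] {k : ℕ} {w : G → ZMod (2 ^ k)} {c : G}

/-! ## §1 Type sums of the flip orbit -/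

/-- **The indicator of a single flip**: `1_{T^{(s)}} = 1_T − δ_s + δ_{cs}` for `s ∈ T` (`c ≠ 1`). [folklore] -/
theorem indG_oflipCM_eq (hc2 : c * c = 1) (hc1 : c ≠ 1) (T : CMF G c) {s : G} (hs : s ∈ T.1) (x : G) :
    indG (oflipCM c hc2 s T).1 x = indG T.1 x - (if x = s then 1 else 0) + (if x = c * s then 1 else 0) := by
  have hcs : c * s ∉ T.1 := (T.2 s).mp hs
  have hne : s ≠ c * s := fun h => hc1 (mul_right_cancel ((one_mul s).trans h)).symm
  show indG (oflip c s T.1) x = _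
  by_cases hx : x ∈ orb c s
  · rw [indG_oflip_of_mem c hx]
    rcases (mem_orb c).mp hx with rfl | rfl
    · unfold indG; rw [if_pos hs, if_pos rfl, if_neg hne]; ring
    · unfold indG; rw [if_neg hcs, if_neg (Ne.symm hne), if_pos rfl]; ring
  · rw [indG_oflip_of_not_mem c hx]
    have h1 : x ≠ s := fun h => hx ((mem_orb c).mpr (Or.inl h))
    have h2 : x ≠ c * s := fun h => hx ((mem_orb c).mpr (Or.inr h))
    rw [if_neg h1, if_neg h2]; ring

/-- **Type sum of a combination of the flip orbit**: `typeSum (Σ_Q b_Q [T^{(s)}·Q⁻¹]) (x) = Σ_Q b_Q 1_T(xQ) − b(x⁻¹s) + b(x⁻¹cs)`. [folklore] -/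
theorem typeSum_sum_smul_single_rt_oflipCM (hc2 : c * c = 1) (hc1 : c ≠ 1) (T : CMF G c) {s : G} (hs : s ∈ T.1) (b : G → ℤ) (x : G) :
    typeSum G c (∑ Q, b Q • Finsupp.single (rt c Q (oflipCM c hc2 s T)) (1 : ℤ)) x =
      (∑ Q, b Q * indG T.1 (x * Q)) - b (x⁻¹ * s) + b (x⁻¹ * (c * s)) := by
  rw [typeSum_sum_baseVec]
  have e : ∀ Q, b Q * indG (oflipCM c hc2 s T).1 (x * Q) =
      b Q * indG T.1 (x * Q) - (if Q = x⁻¹ * s then b Q else 0) + (if Q = x⁻¹ * (c * s) then b Q else 0) := by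
    intro Q
    have h1 : x * Q = s ↔ Q = x⁻¹ * s := ⟨fun h => by rw [← h, inv_mul_cancel_left], fun h => by rw [h, mul_inv_cancel_left]⟩
    have h2 : x * Q = c * s ↔ Q = x⁻¹ * (c * s) :=
      ⟨fun h => by rw [← h, inv_mul_cancel_left], fun h => by rw [h, mul_inv_cancel_left]⟩
    rw [indG_oflipCM_eq hc2 hc1 T hs]
    simp only [h1, h2]
    split_ifs <;> ring
  simp only [e, Finset.sum_add_distrib, Finset.sum_sub_distrib, Finset.sum_ite_eq', Finset.mem_univ, if_true]

/-! ## §2 A Hodge combination on the repaired target has fibre-constant antisymmetrised flip coefficients -/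

/-- **FIBRE CONSTANCY.**  If `z = Σ a_Q [T_0·Q⁻¹] + Σ b_Q [Φ₁·Q⁻¹]` is a Hodge vector (`Φ₁ = T_0^{(s₀)}`, `s₀ ∈ T_0`) then `β(Q) = b_Q − b_{cQ}`
satisfies `β Q = β Q'` whenever `w Q = w Q'`. [folklore] -/
theorem sub_eq_sub_of_mem_hodgeSpan (hw : ∀ P Q : G, w (P * Q) = w P + w Q) (hk : 1 ≤ k) (hc2 : c * c = 1)
    (hcen : ∀ x : G, x * c = c * x) (hwc : w c ≠ 0) {s₀ : G} (hs₀ : s₀ ∈ (arcType hw hk hc2 hwc 0).1) (a b : G → ℤ)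
    (hz : (∑ Q, a Q • Finsupp.single (rt c Q (arcType hw hk hc2 hwc 0)) (1 : ℤ)) +
      (∑ Q, b Q • Finsupp.single (rt c Q (oflipCM c hc2 s₀ (arcType hw hk hc2 hwc 0))) (1 : ℤ)) ∈ hodgeSpan c hc2)
    {Q Q' : G} (hQ : w Q = w Q') : b Q - b (c * Q) = b Q' - b (c * Q') := by
  have hc1 : c ≠ 1 := c_ne_one hw hwc
  obtain ⟨K, hK⟩ := exists_forall_typeSum_eq_of_mem_hodgeSpan c hc2 hcen hz
  have h1 := hK (s₀ * Q⁻¹)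
  have h2 := hK (s₀ * Q'⁻¹)
  have hx : w (s₀ * Q⁻¹) = w (s₀ * Q'⁻¹) := by rw [hw, hw, map_inv hw, map_inv hw, hQ]
  rw [map_add, Pi.add_apply, typeSum_sum_smul_single_rt_oflipCM hc2 hc1 _ hs₀, ← typeSum_sum_baseVec] at h1 h2
  rw [typeSum_sum_smul_single_rt_arcType_eq hw hk hc2 hwc 0 a hx, typeSum_sum_smul_single_rt_arcType_eq hw hk hc2 hwc 0 b hx] at h1
  have e1 : (s₀ * Q⁻¹)⁻¹ * s₀ = Q := by rw [mul_inv_rev, inv_inv, inv_mul_cancel_right]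
  have e2 : (s₀ * Q'⁻¹)⁻¹ * s₀ = Q' := by rw [mul_inv_rev, inv_inv, inv_mul_cancel_right]
  have e3 : (s₀ * Q⁻¹)⁻¹ * (c * s₀) = c * Q := by rw [← hcen, ← mul_assoc, e1, hcen]
  have e4 : (s₀ * Q'⁻¹)⁻¹ * (c * s₀) = c * Q' := by rw [← hcen, ← mul_assoc, e2, hcen]
  rw [e1, e3] at h1
  rw [e2, e4] at h2
  linarith

/-! ## §3 Splitting a combination of a block into pairs and its antisymmetrisation over a transversal -/

/-- **Transversal decomposition**: `Σ_Q b_Q [Ψ·Q⁻¹] = Σ_{Q ∈ T₁} b_{cQ}·pair(Ψ·Q⁻¹) + Σ_{Q ∈ T₁} (b_Q − b_{cQ})·[Ψ·Q⁻¹]` for any CM type `T₁`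
(a transversal of `G/⟨c⟩`). [folklore] -/
theorem sum_smul_single_rt_eq_pairs_add (hc2 : c * c = 1) (Ψ T₁ : CMF G c) (b : G → ℤ) :
    (∑ Q, b Q • Finsupp.single (rt c Q Ψ) (1 : ℤ)) =
      (∑ Q ∈ T₁.1, b (c * Q) • pair c (rt c Q Ψ)) + ∑ Q ∈ T₁.1, (b Q - b (c * Q)) • Finsupp.single (rt c Q Ψ) (1 : ℤ) := by
  rw [sum_eq_sum_type_add c hc2 T₁ (fun Q => b Q • Finsupp.single (rt c Q Ψ) (1 : ℤ)), ← Finset.sum_add_distrib, ← Finset.sum_add_distrib]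
  refine Finset.sum_congr rfl fun Q _ => ?_
  rw [rt_mul, pair, smul_add, sub_smul]
  abel

/-- The pair part lies in `ℤ⟨pairs⟩`. [folklore] -/
theorem sum_smul_pair_mem_span_pairSet (Ψ T₁ : CMF G c) (b : G → ℤ) :
    (∑ Q ∈ T₁.1, b (c * Q) • pair c (rt c Q Ψ)) ∈ Submodule.span ℤ (pairSet c) :=
  Submodule.sum_mem _ fun _ _ => Submodule.smul_mem _ _ (Submodule.subset_span (pair_mem_pairSet c _))

/-- **Membership in `T_0` depends on `w` only.** [folklore] -/
theorem mem_arcType_of_apply_eq (hw : ∀ P Q : G, w (P * Q) = w P + w Q) (hk : 1 ≤ k) (hc2 : c * c = 1) (hwc : w c ≠ 0)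
    {Q Q' : G} (hQ : w Q = w Q') (h : Q' ∈ (arcType hw hk hc2 hwc 0).1) : Q ∈ (arcType hw hk hc2 hwc 0).1 := by
  rw [mem_arcType] at h ⊢
  rwa [hQ]

/-- **The fibres of `w` inside `T_0` are whole fibres**: `{Q ∈ T_0 | w Q = t} = {Q | w Q = t}` as soon as one `Q₀ ∈ T_0` has `w Q₀ = t`. [folklore] -/
theorem filter_arcType_eq_filter (hw : ∀ P Q : G, w (P * Q) = w P + w Q) (hk : 1 ≤ k) (hc2 : c * c = 1) (hwc : w c ≠ 0)
    {t : ZMod (2 ^ k)} {Q₀ : G} (hQ₀ : Q₀ ∈ (arcType hw hk hc2 hwc 0).1) (ht : w Q₀ = t) :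
    (arcType hw hk hc2 hwc 0).1.filter (fun Q => w Q = t) = univ.filter fun Q => w Q = t := by
  ext Q
  simp only [mem_filter, mem_univ, true_and, and_iff_right_iff_imp]
  intro hQ
  exact mem_arcType_of_apply_eq hw hk hc2 hwc (hQ.trans ht.symm) hQ₀

/-- **Regrouping by fibres.**  If `β` is fibre-constant and every fibre sum `Σ_{w Q = t} v_Q` satisfies `2^{j'}·(fibre sum) ∈ M`, then
`2^{j'}·Σ_{Q ∈ T_0} β(Q)·v_Q ∈ M`. [folklore] -/
theorem two_pow_smul_sum_arcType_smul_mem (hw : ∀ P Q : G, w (P * Q) = w P + w Q) (hk : 1 ≤ k) (hc2 : c * c = 1) (hwc : w c ≠ 0)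
    {V : Type*} [AddCommGroup V] (M : Submodule ℤ V) (v : G → V) (β : G → ℤ)
    (hβ : ∀ Q Q' : G, w Q = w Q' → β Q = β Q') (j' : ℕ)
    (hfib : ∀ t : ZMod (2 ^ k), ((2 : ℤ) ^ j') • (∑ Q ∈ univ.filter (fun Q => w Q = t), v Q) ∈ M) :
    ((2 : ℤ) ^ j') • (∑ Q ∈ (arcType hw hk hc2 hwc 0).1, β Q • v Q) ∈ M := by
  rw [← Finset.sum_fiberwise_of_maps_to (s := (arcType hw hk hc2 hwc 0).1) (t := (univ : Finset (ZMod (2 ^ k)))) (g := w)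
    (fun _ _ => mem_univ _) (fun Q => β Q • v Q), Finset.smul_sum]
  refine Submodule.sum_mem _ fun t _ => ?_
  by_cases hne : ((arcType hw hk hc2 hwc 0).1.filter (fun Q => w Q = t)).Nonempty
  · obtain ⟨Q₀, hQ₀⟩ := hne
    have hQ₀T : Q₀ ∈ (arcType hw hk hc2 hwc 0).1 := (mem_filter.mp hQ₀).1
    have hQ₀t : w Q₀ = t := (mem_filter.mp hQ₀).2
    have e : (∑ Q ∈ (arcType hw hk hc2 hwc 0).1 with w Q = t, β Q • v Q) =
        β Q₀ • ∑ Q ∈ univ.filter (fun Q => w Q = t), v Q := by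
      rw [← filter_arcType_eq_filter hw hk hc2 hwc hQ₀T hQ₀t, Finset.smul_sum]
      refine Finset.sum_congr rfl fun Q hQ => ?_
      rw [hβ Q Q₀ ((mem_filter.mp hQ).2.trans hQ₀t.symm)]
    rw [e, smul_comm]
    exact Submodule.smul_mem _ _ (hfib t)
  · rw [Finset.not_nonempty_iff_eq_empty.mp hne, Finset.sum_empty, smul_zero]
    exact Submodule.zero_mem _

/-! ## §4 THE FLIP-ORBIT REDUCTION THEOREM -/

/-- **THE FLIP-ORBIT REDUCTION THEOREM.**  `ℤ⟨pairs⟩ ≤ L ≤ hodgeSpan`; (RED) every type reduces modulo `L` up to `2ʲ` onto the arc block together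
with the flip orbit of `Φ₁ = T_0^{(s₀)}`; (FIB) every fibre sum of the flip orbit reduces modulo `L` up to `2^{j'}` onto the arc block.  Then
`2^{j'+j} · hodgeSpan ≤ L`. [folklore] -/
theorem two_pow_smul_mem_of_flipOrbit_reduction [Fintype (CMF G c)] (hw : ∀ P Q : G, w (P * Q) = w P + w Q) (hk : 1 ≤ k)
    (hc2 : c * c = 1) (hcen : ∀ x : G, x * c = c * x) (hwc : w c ≠ 0) (h1 : ∃ g₁ : G, w g₁ = 1) {s₀ : G}
    (hs₀ : s₀ ∈ (arcType hw hk hc2 hwc 0).1) (L : Submodule ℤ (CMF G c →₀ ℤ)) (hPL : Submodule.span ℤ (pairSet c) ≤ L)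
    (hLH : L ≤ hodgeSpan c hc2) (j j' : ℕ)
    (hred : ∀ Φ : CMF G c, ((2 : ℤ) ^ j) • Finsupp.single Φ (1 : ℤ) ∈
      (L ⊔ Submodule.span ℤ (Set.range fun Q : G => Finsupp.single (rt c Q (arcType hw hk hc2 hwc 0)) (1 : ℤ))) ⊔
        Submodule.span ℤ (Set.range fun Q : G => Finsupp.single (rt c Q (oflipCM c hc2 s₀ (arcType hw hk hc2 hwc 0))) (1 : ℤ)))
    (hfib : ∀ t : ZMod (2 ^ k), ((2 : ℤ) ^ j') •
      (∑ Q ∈ univ.filter (fun Q => w Q = t), Finsupp.single (rt c Q (oflipCM c hc2 s₀ (arcType hw hk hc2 hwc 0))) (1 : ℤ)) ∈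
        L ⊔ Submodule.span ℤ (Set.range fun Q : G => Finsupp.single (rt c Q (arcType hw hk hc2 hwc 0)) (1 : ℤ)))
    {y : CMF G c →₀ ℤ} (hy : y ∈ hodgeSpan c hc2) : ((2 : ℤ) ^ (j' + j)) • y ∈ L := by
  set T₀ := arcType hw hk hc2 hwc 0 with hT₀
  set Φ₁ := oflipCM c hc2 s₀ T₀ with hΦ₁
  -- complete reduction of `2ʲ y`
  obtain ⟨l, hl, f, hf, hsum⟩ := Submodule.mem_sup.mp (two_pow_smul_mem_sup_of_forall_single c Φ₁ _ j hred y)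
  obtain ⟨l₀, hl₀, r, hr, rfl⟩ := Submodule.mem_sup.mp hl
  obtain ⟨a, rfl⟩ := (Submodule.mem_span_range_iff_exists_fun ℤ).mp hr
  obtain ⟨b, rfl⟩ := (Submodule.mem_span_range_iff_exists_fun ℤ).mp hf
  -- the `R`-part is a Hodge vector
  have hzH : (∑ Q, a Q • Finsupp.single (rt c Q T₀) (1 : ℤ)) + (∑ Q, b Q • Finsupp.single (rt c Q Φ₁) (1 : ℤ)) ∈ hodgeSpan c hc2 := by
    have e : (∑ Q, a Q • Finsupp.single (rt c Q T₀) (1 : ℤ)) + (∑ Q, b Q • Finsupp.single (rt c Q Φ₁) (1 : ℤ)) =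
        ((2 : ℤ) ^ j) • y - l₀ := by rw [← hsum]; abel
    rw [e]
    exact Submodule.sub_mem _ (Submodule.smul_mem _ _ hy) (hLH hl₀)
  -- fibre constancy of the antisymmetrised flip coefficients
  have hβ : ∀ Q Q' : G, w Q = w Q' → b Q - b (c * Q) = b Q' - b (c * Q') := fun Q Q' hQ =>
    sub_eq_sub_of_mem_hodgeSpan hw hk hc2 hcen hwc hs₀ a b hzH hQ
  -- the flip part: pairs + fibre sums
  have hflip : ((2 : ℤ) ^ j') • (∑ Q, b Q • Finsupp.single (rt c Q Φ₁) (1 : ℤ)) ∈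
      L ⊔ Submodule.span ℤ (Set.range fun Q : G => Finsupp.single (rt c Q T₀) (1 : ℤ)) := by
    rw [sum_smul_single_rt_eq_pairs_add hc2 Φ₁ T₀ b, smul_add]
    refine Submodule.add_mem _ (Submodule.mem_sup_left (Submodule.smul_mem _ _ (hPL (sum_smul_pair_mem_span_pairSet Φ₁ T₀ b)))) ?_
    exact two_pow_smul_sum_arcType_smul_mem hw hk hc2 hwc _ (fun Q => Finsupp.single (rt c Q Φ₁) (1 : ℤ)) (fun Q => b Q - b (c * Q))
      hβ j' hfib
  -- hence `2^{j'} z ∈ L + arcs`, and the arc remainder is Hodge, so a sum of pairs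
  have hz : ((2 : ℤ) ^ j') • ((∑ Q, a Q • Finsupp.single (rt c Q T₀) (1 : ℤ)) + (∑ Q, b Q • Finsupp.single (rt c Q Φ₁) (1 : ℤ))) ∈
      L ⊔ Submodule.span ℤ (Set.range fun Q : G => Finsupp.single (rt c Q T₀) (1 : ℤ)) := by
    rw [smul_add]
    refine Submodule.add_mem _ (Submodule.mem_sup_right (Submodule.smul_mem _ _ ?_)) hflip
    exact Submodule.sum_mem _ fun Q _ => Submodule.smul_mem _ _ (Submodule.subset_span ⟨Q, rfl⟩)
  obtain ⟨l₁, hl₁, r₁, hr₁, hsum₁⟩ := Submodule.mem_sup.mp hz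
  obtain ⟨a₁, rfl⟩ := (Submodule.mem_span_range_iff_exists_fun ℤ).mp hr₁
  have hr₁H : (∑ Q, a₁ Q • Finsupp.single (rt c Q T₀) (1 : ℤ)) ∈ hodgeSpan c hc2 := by
    have e : (∑ Q, a₁ Q • Finsupp.single (rt c Q T₀) (1 : ℤ)) =
        ((2 : ℤ) ^ j') • ((∑ Q, a Q • Finsupp.single (rt c Q T₀) (1 : ℤ)) + (∑ Q, b Q • Finsupp.single (rt c Q Φ₁) (1 : ℤ))) - l₁ := by
      rw [← hsum₁]; abel
    rw [e]
    exact Submodule.sub_mem _ (Submodule.smul_mem _ _ hzH) (hLH hl₁)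
  have hr₁P := sum_baseVec_arcType_mem_span_pairSet_of_mem_hodgeSpan hw hk hc2 hcen hwc h1 a₁ hr₁H
  -- conclude
  have e : ((2 : ℤ) ^ (j' + j)) • y = ((2 : ℤ) ^ j') • l₀ +
      ((2 : ℤ) ^ j') • ((∑ Q, a Q • Finsupp.single (rt c Q T₀) (1 : ℤ)) + (∑ Q, b Q • Finsupp.single (rt c Q Φ₁) (1 : ℤ))) := by
    rw [pow_add, mul_smul, ← hsum, ← smul_add, add_assoc]
  rw [e, ← hsum₁]
  exact Submodule.add_mem _ (Submodule.smul_mem _ _ hl₀) (Submodule.add_mem _ hl₁ (hPL hr₁P))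

/-! ## §5 Packaged forms: `L = ℤ⟨pairs⟩ + ℤ[G]·S`, one fibre sum, the single flips of `T_0` -/

/-- **Base change moves the fibre sums around**: `Σ_{w Q = t} [Φ·Q⁻¹] = (Σ_{w Q = 0} [Φ·Q⁻¹])·Q_t⁻¹` for any `Q_t` with `w Q_t = t`. [folklore] -/
theorem fibreSum_eq_mapDomain (hw : ∀ P Q : G, w (P * Q) = w P + w Q) (Φ : CMF G c) {t : ZMod (2 ^ k)} {Qt : G} (hQt : w Qt = t) :
    (∑ Q ∈ univ.filter (fun Q => w Q = t), Finsupp.single (rt c Q Φ) (1 : ℤ)) =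
      Finsupp.mapDomain (rt c Qt) (∑ Q ∈ univ.filter (fun Q => w Q = 0), Finsupp.single (rt c Q Φ) (1 : ℤ)) := by
  rw [Finsupp.mapDomain_finsetSum]
  simp_rw [Finsupp.mapDomain_single, ← rt_mul]
  symm
  refine Finset.sum_equiv (Equiv.mulLeft Qt) (fun Q => ?_) (fun Q _ => rfl)
  simp only [mem_filter, mem_univ, true_and, Equiv.coe_mulLeft, hw, hQt]
  exact ⟨fun h => by rw [h, add_zero], fun h => add_left_cancel (h.trans (add_zero t).symm)⟩

/-- **One fibre sum suffices** (`w` onto): if `M` is base-change stable and `2^{j'}·Σ_{w Q = 0} [Φ·Q⁻¹] ∈ M`, then `2^{j'}·Σ_{w Q = t} [Φ·Q⁻¹] ∈ M` for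
every `t`. [folklore] -/
theorem two_pow_smul_fibreSum_mem (hw : ∀ P Q : G, w (P * Q) = w P + w Q) (h1 : ∃ g₁ : G, w g₁ = 1) (Φ : CMF G c)
    (M : Submodule ℤ (CMF G c →₀ ℤ)) (hM : ∀ (Q : G) (y : CMF G c →₀ ℤ), y ∈ M → Finsupp.mapDomain (rt c Q) y ∈ M) (j' : ℕ)
    (hfib₀ : ((2 : ℤ) ^ j') • (∑ Q ∈ univ.filter (fun Q => w Q = 0), Finsupp.single (rt c Q Φ) (1 : ℤ)) ∈ M) (t : ZMod (2 ^ k)) :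
    ((2 : ℤ) ^ j') • (∑ Q ∈ univ.filter (fun Q => w Q = t), Finsupp.single (rt c Q Φ) (1 : ℤ)) ∈ M := by
  obtain ⟨Qt, hQt⟩ := exists_apply_eq hw h1 t
  rw [fibreSum_eq_mapDomain hw Φ hQt, ← Finsupp.mapDomain_smul]
  exact hM Qt _ hfib₀

/-- **The repaired target `𝓣(S) = (ℤ⟨pairs⟩ + ℤ[G]·S + ℤ⟨arc block⟩) + ℤ⟨flip orbit⟩` is base-change stable** (central `c`). [folklore] -/
theorem mapDomain_rt_mem_flipTarget (hcen : ∀ x : G, x * c = c * x) (S : Finset (CMF G c →₀ ℤ)) (T₀ Φ₁ : CMF G c) (Q : G)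
    {y : CMF G c →₀ ℤ}
    (hy : y ∈ ((Submodule.span ℤ (pairSet c) ⊔ Submodule.span ℤ (translates c S)) ⊔
      Submodule.span ℤ (Set.range fun Q : G => Finsupp.single (rt c Q T₀) (1 : ℤ))) ⊔
        Submodule.span ℤ (Set.range fun Q : G => Finsupp.single (rt c Q Φ₁) (1 : ℤ))) :
    Finsupp.mapDomain (rt c Q) y ∈ ((Submodule.span ℤ (pairSet c) ⊔ Submodule.span ℤ (translates c S)) ⊔
      Submodule.span ℤ (Set.range fun Q : G => Finsupp.single (rt c Q T₀) (1 : ℤ))) ⊔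
        Submodule.span ℤ (Set.range fun Q : G => Finsupp.single (rt c Q Φ₁) (1 : ℤ)) := by
  obtain ⟨l, hl, b, hb, rfl⟩ := Submodule.mem_sup.mp hy
  rw [Finsupp.mapDomain_add]
  refine Submodule.add_mem _ (Submodule.mem_sup_left (mapDomain_rt_mem_target c S T₀ hcen Q hl)) (Submodule.mem_sup_right ?_)
  have hle : Submodule.map (Finsupp.lmapDomain ℤ ℤ (rt c Q)) (Submodule.span ℤ (Set.range fun Q : G => Finsupp.single (rt c Q Φ₁) (1 : ℤ))) ≤
      Submodule.span ℤ (Set.range fun Q : G => Finsupp.single (rt c Q Φ₁) (1 : ℤ)) := by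
    rw [Submodule.map_span, Submodule.span_le]
    rintro _ ⟨_, ⟨Q', rfl⟩, rfl⟩
    rw [Finsupp.lmapDomain_apply, Finsupp.mapDomain_single, ← rt_mul]
    exact Submodule.subset_span ⟨Q * Q', rfl⟩
  exact hle (Submodule.mem_map_of_mem hb)

/-- **The flips at the position of `s₀` lie in the flip orbit**: `T_0^{(s)} = Φ₁·(s⁻¹s₀)⁻¹` when `w s = w s₀`, so (flip′) is automatic for them. [folklore] -/
theorem oflipCM_arcType_eq_rt_of_apply_eq (hw : ∀ P Q : G, w (P * Q) = w P + w Q) (hk : 1 ≤ k) (hc2 : c * c = 1) (hwc : w c ≠ 0)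
    {s₀ s : G} (hs : w s = w s₀) :
    oflipCM c hc2 s (arcType hw hk hc2 hwc 0) = rt c (s⁻¹ * s₀) (oflipCM c hc2 s₀ (arcType hw hk hc2 hwc 0)) := by
  rw [rt_oflipCM, rt_arcType, hw, map_inv hw, hs, neg_add_cancel, sub_zero, mul_inv_rev, inv_inv, mul_inv_cancel_left]

/-- Hence `[T_0^{(s)}]` lies in the repaired target for every `s` in the fibre of `s₀` (any `S`, exponent `0`). [folklore] -/
theorem single_oflipCM_mem_flipTarget_of_apply_eq (hw : ∀ P Q : G, w (P * Q) = w P + w Q) (hk : 1 ≤ k) (hc2 : c * c = 1)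
    (hwc : w c ≠ 0) (S : Finset (CMF G c →₀ ℤ)) {s₀ s : G} (hs : w s = w s₀) (j : ℕ) :
    ((2 : ℤ) ^ j) • Finsupp.single (oflipCM c hc2 s (arcType hw hk hc2 hwc 0)) (1 : ℤ) ∈
      ((Submodule.span ℤ (pairSet c) ⊔ Submodule.span ℤ (translates c S)) ⊔
        Submodule.span ℤ (Set.range fun Q : G => Finsupp.single (rt c Q (arcType hw hk hc2 hwc 0)) (1 : ℤ))) ⊔
          Submodule.span ℤ (Set.range fun Q : G => Finsupp.single (rt c Q (oflipCM c hc2 s₀ (arcType hw hk hc2 hwc 0))) (1 : ℤ)) := by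
  rw [oflipCM_arcType_eq_rt_of_apply_eq hw hk hc2 hwc hs]
  exact Submodule.smul_mem _ _ (Submodule.mem_sup_right (Submodule.subset_span ⟨s⁻¹ * s₀, rfl⟩))

/-- **Residual reduction from the single flips of `T_0`, repaired target**: if every `T_0^{(s)}` (`s ∈ T_0`) satisfies `2ʲ·[T_0^{(s)}] ∈ 𝓣(S)`, so does every
type of potential `≤ 1`. [folklore] -/
theorem residual_reduction_of_single_flips' (hc2 : c * c = 1) (hcen : ∀ x : G, x * c = c * x) (S : Finset (CMF G c →₀ ℤ))
    (T₀ Φ₁ : CMF G c) (j : ℕ)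
    (hflip : ∀ s ∈ T₀.1, ((2 : ℤ) ^ j) • Finsupp.single (oflipCM c hc2 s T₀) (1 : ℤ) ∈
      ((Submodule.span ℤ (pairSet c) ⊔ Submodule.span ℤ (translates c S)) ⊔
        Submodule.span ℤ (Set.range fun Q : G => Finsupp.single (rt c Q T₀) (1 : ℤ))) ⊔
          Submodule.span ℤ (Set.range fun Q : G => Finsupp.single (rt c Q Φ₁) (1 : ℤ))) :
    ∀ Ψ : CMF G c, bpot c T₀ Ψ ≤ 1 → ((2 : ℤ) ^ j) • Finsupp.single Ψ (1 : ℤ) ∈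
      ((Submodule.span ℤ (pairSet c) ⊔ Submodule.span ℤ (translates c S)) ⊔
        Submodule.span ℤ (Set.range fun Q : G => Finsupp.single (rt c Q T₀) (1 : ℤ))) ⊔
          Submodule.span ℤ (Set.range fun Q : G => Finsupp.single (rt c Q Φ₁) (1 : ℤ)) := by
  intro Ψ hΨ
  rcases residual_cases c T₀ hc2 hΨ with ⟨Q, rfl⟩ | ⟨Q, s, hs, rfl⟩
  · exact Submodule.smul_mem _ _ (Submodule.mem_sup_left (single_rt_mem_target c S T₀ Q))
  · have h := mapDomain_rt_mem_flipTarget hcen S T₀ Φ₁ Q (hflip s hs)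
    rwa [Finsupp.mapDomain_smul, Finsupp.mapDomain_single] at h

/-- **Packaged: the flip-orbit reduction modulo `ℤ⟨pairs⟩ + ℤ[G]·S` with ONE fibre sum** — produces the hypothesis `htwo` of gen 38/40ʼs splitting
theorems (`Splitting.isLeast_card_gfaces_generate_of_isPGroup(_rel)`, `…_of_cover_of_supported`). [folklore] -/
theorem two_pow_smul_mem_psp_of_flipOrbit_reduction [Fintype (CMF G c)] (hw : ∀ P Q : G, w (P * Q) = w P + w Q) (hk : 1 ≤ k)
    (hc2 : c * c = 1) (hcen : ∀ x : G, x * c = c * x) (hwc : w c ≠ 0) (h1 : ∃ g₁ : G, w g₁ = 1) {s₀ : G}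
    (hs₀ : s₀ ∈ (arcType hw hk hc2 hwc 0).1) (S : Finset (CMF G c →₀ ℤ)) (hS : (↑S : Set (CMF G c →₀ ℤ)) ⊆ hodgeSpan c hc2)
    (j j' : ℕ)
    (hred : ∀ Φ : CMF G c, ((2 : ℤ) ^ j) • Finsupp.single Φ (1 : ℤ) ∈
      ((Submodule.span ℤ (pairSet c) ⊔ Submodule.span ℤ (translates c S)) ⊔
        Submodule.span ℤ (Set.range fun Q : G => Finsupp.single (rt c Q (arcType hw hk hc2 hwc 0)) (1 : ℤ))) ⊔
          Submodule.span ℤ (Set.range fun Q : G => Finsupp.single (rt c Q (oflipCM c hc2 s₀ (arcType hw hk hc2 hwc 0))) (1 : ℤ)))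
    (hfib₀ : ((2 : ℤ) ^ j') •
      (∑ Q ∈ univ.filter (fun Q => w Q = 0), Finsupp.single (rt c Q (oflipCM c hc2 s₀ (arcType hw hk hc2 hwc 0))) (1 : ℤ)) ∈
        (Submodule.span ℤ (pairSet c) ⊔ Submodule.span ℤ (translates c S)) ⊔
          Submodule.span ℤ (Set.range fun Q : G => Finsupp.single (rt c Q (arcType hw hk hc2 hwc 0)) (1 : ℤ))) :
    ∀ y ∈ hodgeSpan c hc2, ((2 : ℤ) ^ (j' + j)) • y ∈ Submodule.span ℤ (pairSet c) ⊔ Submodule.span ℤ (translates c S) := by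
  intro y hy
  refine two_pow_smul_mem_of_flipOrbit_reduction hw hk hc2 hcen hwc h1 hs₀ _ le_sup_left (psp_le_hodgeSpan c hc2 hcen S hS) j j' hred
    (two_pow_smul_fibreSum_mem hw h1 _ _ (fun Q y hy => mapDomain_rt_mem_target c S _ hcen Q hy) j' hfib₀) hy

/-- **THE SINGLE-FLIP FORM, REPAIRED (flip′ + FIB).**  If `S ⊆ hodgeSpan` contains (the base changes of) a cover of the arc type — every type reduces
INTEGRALLY to the types of potential `≤ 1` modulo `ℤ⟨pairs⟩ + ℤ[G]·S` —, every single flip `T_0^{(s)}` (`s ∈ T_0`) reduces up to `2ʲ` onto the arc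
block TOGETHER WITH the flip orbit of `T_0^{(s₀)}`, and the fibre sum of that orbit over `w = 0` reduces up to `2^{j'}` onto the arc block, then
`2^{j'+j} · hodgeSpan ≤ ℤ⟨pairs⟩ + ℤ[G]·S`.  (Part XI: with the arc block alone in place of the flip orbit the hypothesis cannot be met.) [folklore] -/
theorem two_pow_smul_mem_psp_of_single_flips' [Fintype (CMF G c)] (hw : ∀ P Q : G, w (P * Q) = w P + w Q) (hk : 1 ≤ k)
    (hc2 : c * c = 1) (hcen : ∀ x : G, x * c = c * x) (hwc : w c ≠ 0) (h1 : ∃ g₁ : G, w g₁ = 1) {s₀ : G}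
    (hs₀ : s₀ ∈ (arcType hw hk hc2 hwc 0).1) (S : Finset (CMF G c →₀ ℤ)) (hS : (↑S : Set (CMF G c →₀ ℤ)) ⊆ hodgeSpan c hc2)
    (j j' : ℕ)
    (hcov : ∀ Φ : CMF G c, Finsupp.single Φ (1 : ℤ) ∈
      (Submodule.span ℤ (pairSet c) ⊔ Submodule.span ℤ (translates c S)) ⊔
        Submodule.span ℤ ((fun Ψ => Finsupp.single Ψ (1 : ℤ)) '' {Ψ : CMF G c | bpot c (arcType hw hk hc2 hwc 0) Ψ ≤ 1}))
    (hflip : ∀ s ∈ (arcType hw hk hc2 hwc 0).1, ((2 : ℤ) ^ j) • Finsupp.single (oflipCM c hc2 s (arcType hw hk hc2 hwc 0)) (1 : ℤ) ∈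
      ((Submodule.span ℤ (pairSet c) ⊔ Submodule.span ℤ (translates c S)) ⊔
        Submodule.span ℤ (Set.range fun Q : G => Finsupp.single (rt c Q (arcType hw hk hc2 hwc 0)) (1 : ℤ))) ⊔
          Submodule.span ℤ (Set.range fun Q : G => Finsupp.single (rt c Q (oflipCM c hc2 s₀ (arcType hw hk hc2 hwc 0))) (1 : ℤ)))
    (hfib₀ : ((2 : ℤ) ^ j') •
      (∑ Q ∈ univ.filter (fun Q => w Q = 0), Finsupp.single (rt c Q (oflipCM c hc2 s₀ (arcType hw hk hc2 hwc 0))) (1 : ℤ)) ∈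
        (Submodule.span ℤ (pairSet c) ⊔ Submodule.span ℤ (translates c S)) ⊔
          Submodule.span ℤ (Set.range fun Q : G => Finsupp.single (rt c Q (arcType hw hk hc2 hwc 0)) (1 : ℤ))) :
    ∀ y ∈ hodgeSpan c hc2, ((2 : ℤ) ^ (j' + j)) • y ∈ Submodule.span ℤ (pairSet c) ⊔ Submodule.span ℤ (translates c S) := by
  refine two_pow_smul_mem_psp_of_flipOrbit_reduction hw hk hc2 hcen hwc h1 hs₀ S hS j j' (fun Φ => ?_) hfib₀
  refine reduction_of_residual c (oflipCM c hc2 s₀ (arcType hw hk hc2 hwc 0)) _ {Ψ : CMF G c | bpot c (arcType hw hk hc2 hwc 0) Ψ ≤ 1} j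
    (fun Φ' => ?_) (residual_reduction_of_single_flips' hc2 hcen S _ _ j hflip) Φ
  exact Submodule.mem_sup.mpr (by
    obtain ⟨l, hl, r, hr, e⟩ := Submodule.mem_sup.mp (hcov Φ')
    exact ⟨l, Submodule.mem_sup_left hl, r, hr, e⟩)

end

end Summit.HodgeConjecture.CorCM.Census.CyclicCharacter
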